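import Literature.MathematicalPhysics.QuantumFieldTheory.Balaban1983to89.B9Thm37GlueTorusCovPoinc
import Literature.MathematicalPhysics.QuantumFieldTheory.Balaban1983to89.Beta.CombesThomasFormOp

/-!
# Literature: Bałaban's propagators for lattice gauge theories [B9] — COMBES–THOMAS DECAY of the inverse of
Δ_U + a·Q_UᵀQ_U, uniform in the transport and in the volume (pv21 node HOM-PU-COVCT; MODEL)

Sources (bib keys):
* [B9] = `Balaban1985BackgroundPropagators` — T. Bałaban, *Propagators for lattice gauge theories in a background
  field*, Commun. Math. Phys. 99 (1985) 389–434.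
* [CT] = `CombesThomas1973` — J.-M. Combes, L. Thomas, *Asymptotic behaviour of eigenfunctions for multiparticle
  Schrödinger operators*, Commun. Math. Phys. 34 (1973) 251–270 (the conjugation argument; certified in elementary
  finite-dimensional form in the imported `Beta.CombesThomasForm` / `Beta.CombesThomasFormOp`, whose
  `combesThomas_form_op` is reused here, not re-proved).
* [B4] = `Balaban1984PropagatorsI` — T. Bałaban, *Propagators and renormalization transformations for lattice gauge
  theories. I*, Commun. Math. Phys. 95 (1984) 17–40 (context only: the scalar U ≡ 1 operator Δ + aQ\*Q and the
  conjugation route named on its p. 36, quoted in the header of `Beta.CombesThomasFormOp`; nothing of [B4] is quoted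
  or used here).

THE PRINTED LOCI.  NO new «» span in this file.  Context, quoted in the headers/docstrings of modules this file
imports: [B9] (3.18)–(3.19) p. 393 (the one-step covariant averaging Q′(V); `B9Thm37GlueTorusCov`), (3.3)
pp. 390–391 (∇_U; `B9Thm37Glue`), (3.23)–(3.24) p. 394 (Δ′_a = Δ_U + Q′\*aQ′; `B9Thm37Glue`), p. 395 *"Assuming some
regularity of the configuration U it can be easily shown that the operator Δ′_a is positive."* (`B9Thm37Glue`,
`B9Thm37GlueTorusInv`), and Theorem 3.1 with its display (3.42) p. 397 (`B9Thm37Glue`): exponential decay bounds —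
for y ∈ Λ_j, x ∈ Δ(y) and λ supported in Δ(y′) the four quantities |(G′(U)λ)(x)|, |(∇_U G′(U)λ)(x)|,
|(G′(U)∇\*_U λ)(x)|, |(Δ_U G′(U)λ)(x)| are at most B₀ times the SCALE PREFACTOR (L^jη)², L^jη, L^jη, 1 respectively,
times e^{−δ₀d(y,y′)}·|λ| (|λ| the supremum norm (3.39)), with δ₀, B₀ depending on d and L only, stated "for an
arbitrary configuration U satisfying the regularity condition (3.35)" (a paraphrase of the shape of Theorem 3.1
from the page text and from this directory's rendering `B9.KernelFamily` / `B9.pref4`; only the phrase in quotation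
marks is verbatim; v1 of this header gave the first entry without its prefactor (L^jη)² — v1.1 = this DOCFIX,
docstring-only, all declarations and statements unchanged).

THE POINT.  The lineage's one-step MODEL of Δ′_a is `covLapCov K c w Rm a` = D\*D + a·Q_UᵀQ_U over an abstract comb
(`B9Thm37GlueTorusCov`); `B9Thm37GlueTorusCovPoinc.coercive_covLapCov` gives σ·‖f‖² ≤ ⟨f, (Δ_U + a·Q_UᵀQ_U)f⟩ with
σ = (1/(a·w_min²) + D·n/c_min²)⁻¹ seeing neither the transport nor the volume, and `inverse_sq_le` the ℓ² bound
σ⁻¹ of the inverse — but NO DECAY.  This file proves the (3.42)-SHAPED statement for the model: EXPONENTIAL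
OFF-DIAGONAL DECAY OF THE INVERSE KERNEL with constants independent of U and of the torus, by the Combes–Thomas
conjugation argument in the kernel-certified form `Beta.CombesThomasFormOp.combesThomas_form_op` (any real matrix H
with σ‖ω‖² ≤ ⟨ω, Hω⟩ and a form bound −(σ/2)‖w‖² on the conjugation error Σ_{jk}(e^{φ_j−φ_k} − 1)H_{jk}w_j w_k).
What is new is the CONJUGATION-ERROR BOUND FOR A COVARIANT OPERATOR, UNIFORM IN THE TRANSPORT:

* §1–§2 an elementary exponential inequality; the conjugated field e^{φ}v (`expW`; a SITE weight φ : St → ℝ acting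
  diagonally in the colour index); the conjugation error `conjErr A φ v` = ⟨e^{φ}v, A e^{−φ}v⟩ − ⟨v, Av⟩ of an
  endomorphism and its matrix form `conjErr_eq_matrix` (the quantity in `combesThomas_form_op`'s hypothesis);
  fibre counting `sum_comp_le_of_card_fiber_le`.
* §3 the ∇_U-part (`dPart_ge`): per bond, (∇_U e^{φ}v)(∇_U e^{−φ}v) − (∇_U v)² = −c(b)²(e^t + e^{−t} − 2)·(R(b)v(b₊))_k·
  v(b₋)_k EXACTLY (`bond_term`; t = φ(b₊) − φ(b₋)) — the transport enters only through the ISOMETRY R(b)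
  (`sum_sq_Rm_apply`), so with |t| ≤ θ, |c| ≤ c_max and bond degrees ≤ z the error is ≥ −c_max²(e^θ − 1)z·‖v‖²,
  whatever U is.
* §4 the Q_U-part (`qPart_ge`): Q_U(e^{±φ}v)(β, i) = w(β)Σ_{x∈β} e^{±φ(x)} g(x)_i with g(x) = (tr x)v(x) the
  transported site vector (`gtr`, `covMean_expW`), so the error per (β, i) is
  w(β)²·Σ_{x,x′∈β}(e^{φ(x)−φ(x′)} − 1)g(x)_i g(x′)_i ≥ −w_max²(e^{2Dθ} − 1)·n·Σ_{x∈β} g(x)_i² (oscillation ≤ 2Dθ of φ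
  over a block along the comb, `abs_sub_le_of_blk_eq`; Cauchy–Schwarz), and Σ_β Σ_i Σ_{x∈β} g(x)_i² = ‖v‖² because
  every tr x is an isometry (`sum_sq_eq_sum_sq_tr` of node HOM-PU-COVPOINC).
* §5 `bilin_covLapCov` (the bilinear form), `conjErr_covLapCov_ge`: ERR ≥ −κ(θ)‖v‖² with
  κ(θ) = c_max²(e^θ − 1)z + a·w_max²(e^{2Dθ} − 1)n (`kappa`); with `coercive_covLapCov` this feeds
  `combesThomas_form_op`: **`weighted_inverse_sq_le`** ‖e^{φ}(Δ_U + a·Q_UᵀQ_U)⁻¹g‖ ≤ (2/σ)‖e^{φ}g‖ for EVERY g and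
  EVERY bond-θ-Lipschitz site weight φ with κ(θ) ≤ σ/2, and the ENTRYWISE form **`entry_le`**:
  |(Δ_U + a·Q_UᵀQ_U)⁻¹(p, p₀)| ≤ (2/σ)·e^{−(φ(p) − φ(p₀))}.
* §6 an explicit admissible rate `thetaAdm` = min(1/(2D+1), σ/(2L+1)), L = 2c_max²z + 4a·w_max²·D·n, with
  `kappa_thetaAdm_le`: κ(θ_adm) ≤ σ/2 (from |e^x − 1| ≤ 2|x| on |x| ≤ 1).
* §7 the torus `UT N`, M₀ ∣ N_i, comb `torusComb` of `B9Thm37GlueTorusCov`: bond degrees ≤ d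
  (`card_filter_bsrc_le`, `card_filter_btgt_le`), depth ≤ d(M₀ − 1) and blocks of ≤ M₀^d sites (node
  HOM-PU-COVPOINC), φ = θ·dist(p₀, ·) is bond-θ-Lipschitz (`abs_sub_dist_le`, from `B5Leibniz121.dist_up_le`); hence
  **`entry_decay_torus`** and, with θ_T = `thetaTorus d M₀ a wmin cmin cmax wmax` > 0 (`thetaTorus_pos`),
  **`entry_decay_torus_explicit`**:
      |(Δ_U + a·Q_UᵀQ_U)⁻¹(p, p₀)| ≤ (2/σ_T)·e^{−θ_T·dist(p₀, p)}
  for EVERY torus, EVERY isometric transport and all weights c_min ≤ |c| ≤ c_max, w_min ≤ |w| ≤ w_max — σ_T, θ_T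
  depend on (d, M₀, a, c_min, c_max, w_min, w_max) only.

NOT ASSERTED.  Anything printed: Theorem 3.1 / (3.42) concern print's multiscale G′(U) (the j-fold averaging
operators over L^j-blocks, the weighted distance d(y, y′), L^∞-type norms, the regularity condition (3.35) on U,
constants depending on d and L only) and are print's claims about print's operator; they are neither formalised nor
approximated here, and the random-walk expansion by which [B9] §3 proves them is not touched.  The MODEL statement
differs visibly: one scale, cubic blocks of side M₀, the lattice distance of `UT N`, ℓ²/entrywise norms, NO
regularity of U (the one-step comb mean reproduces every covariantly constant field exactly, so the transport enters
only through isometries), and crude constants — the comb Poincaré constant D·n = d(M₀−1)M₀^d of node HOM-PU-COVPOINC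
inside σ_T and a rate θ_T = min(1/(2d(M₀−1)+1), σ_T/(2L+1)), far from any printed δ₀.

This module is additive: it imports `B9Thm37GlueTorusCovPoinc` and `Beta.CombesThomasFormOp` only and modifies
nothing.  Every declaration is tagged `[folklore]` (finite-dimensional linear algebra / counting / calculus) or
cites the printed locus it MODELS.  Value = kernel certificate for the lineage's one-scale model, NOT summit
progress; NOT continuum, NOT Clay.
-/

namespace Literature.MathematicalPhysics.QuantumFieldTheory.Balaban1983to89.B9Thm37GlueTorusCovCT

open Finset B9Thm37Sum B9Thm37Glue B9Thm37GluePU B9Thm37GlueTorusInv B9Thm37GlueTorusCov B9Thm37GlueTorusCovPoinc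
open Beta.CombesThomasForm (abs_exp_sub_one_le)
open Beta.CombesThomasFormOp (combesThomas_form_op)
open B5TorusCover (UT Ctr)
open B5Leibniz121 (up dn up_dn dist_up_le)

noncomputable section

/-! ## §1  An elementary exponential bound -/

section ExpBounds

/-- |t| ≤ θ ⇒ e^t + e^{−t} − 2 ≤ e^θ − 1 (the companion facts 2 ≤ e^t + e^{−t} and |e^t − 1| ≤ e^Θ − 1 for
|t| ≤ Θ are taken from Mathlib's `Real.one_le_cosh` and the imported `Beta.CombesThomasForm.abs_exp_sub_one_le`).
[folklore] -/
theorem exp_add_exp_neg_sub_two_le_of_abs_le {t θ : ℝ} (ht : |t| ≤ θ) :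
    Real.exp t + Real.exp (-t) - 2 ≤ Real.exp θ - 1 := by
  obtain ⟨h1, h2⟩ := abs_le.mp ht
  by_cases h : 0 ≤ t
  · have ha : Real.exp (-t) ≤ 1 := Real.exp_le_one_iff.mpr (by linarith)
    have hb : Real.exp t ≤ Real.exp θ := Real.exp_le_exp.mpr h2
    linarith
  · have ha : Real.exp t ≤ 1 := Real.exp_le_one_iff.mpr (le_of_lt (not_le.mp h))
    have hb : Real.exp (-t) ≤ Real.exp θ := Real.exp_le_exp.mpr (by linarith)
    linarith

end ExpBounds

/-! ## §2  The conjugated field and the conjugation error of an endomorphism -/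

section Generic

variable {St Bd B Cp : Type}

/-- Conjugation of a field on St × Cp by the site weight e^{φ}: (e^{φ}v)(x, i) = e^{φ(x)}·v(x, i)
(MODEL bookkeeping). [folklore] -/
def expW (φ : St → ℝ) (v : St × Cp → ℝ) : St × Cp → ℝ := fun p => Real.exp (φ p.1) * v p

/-- [folklore] -/
theorem expW_apply (φ : St → ℝ) (v : St × Cp → ℝ) (x : St) (i : Cp) :
    expW φ v (x, i) = Real.exp (φ x) * v (x, i) := rfl

/-- **The conjugation error** ERR_φ(A; v) = ⟨e^{φ}v, A(e^{−φ}v)⟩ − ⟨v, Av⟩ of an endomorphism A of the fields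
(MODEL bookkeeping). [folklore] -/
def conjErr [Fintype St] [Fintype Cp] (A : Module.End ℝ (St × Cp → ℝ)) (φ : St → ℝ) (v : St × Cp → ℝ) : ℝ :=
  ∑ p, expW φ v p * A (expW (fun x => -φ x) v) p - ∑ p, v p * A v p

/-- Matrix form of the conjugation error: ERR_φ(A; v) = Σ_j Σ_k (e^{φ_j − φ_k} − 1)·H_{jk}·v_j v_k with H the matrix
of A in the standard basis — the quantity bounded in the hypothesis `herr` of `Beta.CombesThomasFormOp`.
[folklore] -/
theorem conjErr_eq_matrix [Fintype St] [DecidableEq St] [Fintype Cp] [DecidableEq Cp]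
    (A : Module.End ℝ (St × Cp → ℝ)) (φ : St → ℝ) (v : St × Cp → ℝ) :
    conjErr A φ v = ∑ j, ∑ k, (Real.exp (φ j.1 - φ k.1) - 1) * LinearMap.toMatrix' A j k * (v j * v k) := by
  have happ : ∀ (u : St × Cp → ℝ) (j : St × Cp), A u j = ∑ k, LinearMap.toMatrix' A j k * u k := by
    intro u j
    have h : (LinearMap.toMatrix' A).mulVec u = A u := by
      rw [← Matrix.toLin'_apply, Matrix.toLin'_toMatrix']
    rw [← h]
    rfl
  unfold conjErr
  simp_rw [happ]
  rw [← Finset.sum_sub_distrib]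
  refine Finset.sum_congr rfl fun j _ => ?_
  rw [Finset.mul_sum, Finset.mul_sum, ← Finset.sum_sub_distrib]
  refine Finset.sum_congr rfl fun k _ => ?_
  simp only [expW, Real.exp_sub, Real.exp_neg]
  ring

/-- Fibre counting: if every fibre of π : Bd → St has at most z elements and F ≥ 0, then
Σ_b F(π b) ≤ z·Σ_x F(x). [folklore] -/
theorem sum_comp_le_of_card_fiber_le [Fintype St] [DecidableEq St] [Fintype Bd] (π : Bd → St) {z : ℕ}
    (hz : ∀ x, (univ.filter fun b => π b = x).card ≤ z) (F : St → ℝ) (hF : ∀ x, 0 ≤ F x) :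
    ∑ b, F (π b) ≤ z * ∑ x, F x := by
  rw [← Finset.sum_fiberwise_of_maps_to (s := univ) (t := univ) (g := π) (fun b _ => mem_univ _), Finset.mul_sum]
  refine Finset.sum_le_sum fun x _ => ?_
  rw [Finset.sum_congr rfl fun b hb => show F (π b) = F x by rw [(mem_filter.mp hb).2], Finset.sum_const,
    nsmul_eq_mul]
  exact mul_le_mul_of_nonneg_right (by exact_mod_cast hz x) (hF x)

/-! ## §3  The covariant-derivative part of the error -/

variable {src tgt : Bd → St} (K : Comb src tgt B) (c : Bd → ℝ) (w : B → ℝ) (Rm : Bd → Cp → Cp → ℝ)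

/-- Isometry of the bond matrices: Σ_k (R(b)u)_k² = Σ_j u_j² (from RᵀR = 1). [folklore] -/
theorem sum_sq_Rm_apply [Fintype Cp] [DecidableEq Cp]
    (hRm : ∀ b i j, ∑ k, Rm b k i * Rm b k j = if i = j then (1 : ℝ) else 0) (b : Bd) (u : Cp → ℝ) :
    ∑ k, (∑ j, Rm b k j * u j) ^ 2 = ∑ j, u j ^ 2 := by
  calc ∑ k, (∑ j, Rm b k j * u j) ^ 2
      = ∑ k, ∑ j, ∑ l, Rm b k j * u j * (Rm b k l * u l) := by
        refine Finset.sum_congr rfl fun k _ => ?_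
        rw [sq, Finset.sum_mul_sum]
    _ = ∑ j, ∑ l, u j * u l * ∑ k, Rm b k j * Rm b k l := by
        rw [Finset.sum_comm]
        refine Finset.sum_congr rfl fun j _ => ?_
        rw [Finset.sum_comm]
        refine Finset.sum_congr rfl fun l _ => ?_
        rw [Finset.mul_sum]
        exact Finset.sum_congr rfl fun k _ => by ring
    _ = ∑ j, ∑ l, u j * u l * (if j = l then (1 : ℝ) else 0) := by
        refine Finset.sum_congr rfl fun j _ => Finset.sum_congr rfl fun l _ => ?_
        rw [hRm b j l]
    _ = ∑ j, u j ^ 2 := by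
        refine Finset.sum_congr rfl fun j _ => ?_
        rw [Finset.sum_eq_single j (fun l _ hl => by rw [if_neg (Ne.symm hl), mul_zero])
          (fun h => absurd (mem_univ j) h)]
        simp [sq]

/-- ∇_U of a conjugated field: (∇_U e^{φ}v)(b, k) = c(b)·(e^{φ(b₊)}(R(b)v(b₊))_k − e^{φ(b₋)}v(b₋)_k). [folklore] -/
theorem covD_expW [Fintype Cp] (φ : St → ℝ) (v : St × Cp → ℝ) (q : Bd × Cp) :
    covD src tgt c Rm (expW φ v) q = c q.1 * (Real.exp (φ (tgt q.1)) * ∑ j, Rm q.1 q.2 j * v (tgt q.1, j) -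
      Real.exp (φ (src q.1)) * v (src q.1, q.2)) := by
  have e : ∑ j, Rm q.1 q.2 j * expW φ v (tgt q.1, j) = Real.exp (φ (tgt q.1)) * ∑ j, Rm q.1 q.2 j * v (tgt q.1, j) := by
    rw [Finset.mul_sum]
    exact Finset.sum_congr rfl fun j _ => by rw [expW_apply]; ring
  rw [covD_apply, e, expW_apply]

/-- **The bond identity**: (∇_U e^{φ}v)(b,k)·(∇_U e^{−φ}v)(b,k) − ((∇_U v)(b,k))² =
−c(b)²·(e^{t} + e^{−t} − 2)·(R(b)v(b₊))_k·v(b₋)_k, t = φ(b₊) − φ(b₋). [folklore] -/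
theorem bond_term [Fintype Cp] (φ : St → ℝ) (v : St × Cp → ℝ) (q : Bd × Cp) :
    covD src tgt c Rm (expW φ v) q * covD src tgt c Rm (expW (fun x => -φ x) v) q - covD src tgt c Rm v q ^ 2 =
      -(c q.1 ^ 2 * (Real.exp (φ (tgt q.1) - φ (src q.1)) + Real.exp (-(φ (tgt q.1) - φ (src q.1))) - 2) *
        ((∑ j, Rm q.1 q.2 j * v (tgt q.1, j)) * v (src q.1, q.2))) := by
  rw [covD_expW, covD_expW, covD_apply]
  set r := ∑ j, Rm q.1 q.2 j * v (tgt q.1, j)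
  set s := v (src q.1, q.2)
  have h1 : Real.exp (φ (tgt q.1)) * Real.exp (-φ (tgt q.1)) = 1 := by
    rw [← Real.exp_add, add_neg_cancel, Real.exp_zero]
  have h2 : Real.exp (φ (src q.1)) * Real.exp (-φ (src q.1)) = 1 := by
    rw [← Real.exp_add, add_neg_cancel, Real.exp_zero]
  have h3 : Real.exp (φ (tgt q.1) - φ (src q.1)) = Real.exp (φ (tgt q.1)) * Real.exp (-φ (src q.1)) := by
    rw [show φ (tgt q.1) - φ (src q.1) = φ (tgt q.1) + -φ (src q.1) by ring, Real.exp_add]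
  have h4 : Real.exp (-(φ (tgt q.1) - φ (src q.1))) = Real.exp (φ (src q.1)) * Real.exp (-φ (tgt q.1)) := by
    rw [show -(φ (tgt q.1) - φ (src q.1)) = φ (src q.1) + -φ (tgt q.1) by ring, Real.exp_add]
  rw [h3, h4]
  linear_combination (c q.1 ^ 2 * r ^ 2) * h1 + (c q.1 ^ 2 * s ^ 2) * h2

/-- Per-bond lower bound: 0 ≤ C ≤ T ⇒ −T·(r² + s²)/2 ≤ −C·r·s. [folklore] -/
theorem neg_mul_mul_ge {C T r s : ℝ} (hC0 : 0 ≤ C) (hCT : C ≤ T) :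
    -(T * ((r ^ 2 + s ^ 2) / 2)) ≤ -(C * (r * s)) := by
  nlinarith [mul_nonneg hC0 (sq_nonneg (r - s)), mul_nonneg (sub_nonneg.mpr hCT) (add_nonneg (sq_nonneg r) (sq_nonneg s))]

/-- **The ∇_U-part of the conjugation error.** For isometric bond matrices, |c(b)| ≤ c_max, a site weight φ with
|φ(b₊) − φ(b₋)| ≤ θ on every bond (θ ≥ 0) and at most z bonds starting resp. ending at any site:
Σ_q (∇_U e^{φ}v)(q)(∇_U e^{−φ}v)(q) − Σ_q ((∇_U v)(q))² ≥ −c_max²·(e^θ − 1)·z·Σ_p v(p)². [folklore] -/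
theorem dPart_ge [Fintype St] [DecidableEq St] [Fintype Bd] [Fintype Cp] [DecidableEq Cp]
    (hRm : ∀ b i j, ∑ k, Rm b k i * Rm b k j = if i = j then (1 : ℝ) else 0)
    {cmax : ℝ} (hc' : ∀ b, |c b| ≤ cmax) {θ : ℝ} (hθ : 0 ≤ θ) (φ : St → ℝ)
    (hφ : ∀ b, |φ (tgt b) - φ (src b)| ≤ θ) {z : ℕ}
    (hzs : ∀ x, (univ.filter fun b => src b = x).card ≤ z) (hzt : ∀ x, (univ.filter fun b => tgt b = x).card ≤ z)
    (v : St × Cp → ℝ) :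
    -(cmax ^ 2 * (Real.exp θ - 1) * z * ∑ p, v p ^ 2) ≤
      ∑ q, covD src tgt c Rm (expW φ v) q * covD src tgt c Rm (expW (fun x => -φ x) v) q -
        ∑ q, covD src tgt c Rm v q ^ 2 := by
  have hch : ∀ t : ℝ, 0 ≤ Real.exp t + Real.exp (-t) - 2 := fun t => by
    have h := Real.one_le_cosh t
    rw [Real.cosh_eq] at h
    linarith
  set T := cmax ^ 2 * (Real.exp θ - 1) with hT
  have hT0 : 0 ≤ T := mul_nonneg (sq_nonneg _) (by linarith [Real.one_le_exp_iff.mpr hθ])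
  -- the site energies
  set F : St → ℝ := fun x => ∑ k, v (x, k) ^ 2 with hF
  have hF0 : ∀ x, 0 ≤ F x := fun x => Finset.sum_nonneg fun k _ => sq_nonneg _
  have hFsum : ∑ x, F x = ∑ p, v p ^ 2 := by
    simp only [hF]
    exact (Fintype.sum_prod_type (fun p : St × Cp => v p ^ 2)).symm
  -- termwise bound
  have hterm : ∀ q : Bd × Cp,
      -(T * (((∑ j, Rm q.1 q.2 j * v (tgt q.1, j)) ^ 2 + v (src q.1, q.2) ^ 2) / 2)) ≤
        covD src tgt c Rm (expW φ v) q * covD src tgt c Rm (expW (fun x => -φ x) v) q -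
          covD src tgt c Rm v q ^ 2 := by
    intro q
    rw [bond_term]
    have hsq : c q.1 ^ 2 ≤ cmax ^ 2 := by
      rw [← sq_abs (c q.1)]
      exact pow_le_pow_left₀ (abs_nonneg _) (hc' q.1) 2
    refine neg_mul_mul_ge (mul_nonneg (sq_nonneg _) (hch _)) ?_
    exact mul_le_mul hsq (exp_add_exp_neg_sub_two_le_of_abs_le (hφ q.1)) (hch _) (sq_nonneg _)
  -- sum of the termwise bounds
  have hsum : ∑ q : Bd × Cp, -(T * (((∑ j, Rm q.1 q.2 j * v (tgt q.1, j)) ^ 2 + v (src q.1, q.2) ^ 2) / 2)) =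
      -(T / 2) * (∑ b, F (tgt b) + ∑ b, F (src b)) := by
    have e : ∀ q : Bd × Cp, -(T * (((∑ j, Rm q.1 q.2 j * v (tgt q.1, j)) ^ 2 + v (src q.1, q.2) ^ 2) / 2)) =
        -(T / 2) * ((∑ j, Rm q.1 q.2 j * v (tgt q.1, j)) ^ 2 + v (src q.1, q.2) ^ 2) := fun q => by ring
    simp_rw [e]
    rw [← Finset.mul_sum, ← Finset.sum_add_distrib]
    congr 1
    rw [Fintype.sum_prod_type]
    refine Finset.sum_congr rfl fun b _ => ?_
    rw [Finset.sum_add_distrib, sum_sq_Rm_apply Rm hRm b (fun j => v (tgt b, j))]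
  have htgt := sum_comp_le_of_card_fiber_le tgt hzt F hF0
  have hsrc := sum_comp_le_of_card_fiber_le src hzs F hF0
  calc -(cmax ^ 2 * (Real.exp θ - 1) * z * ∑ p, v p ^ 2)
      = -(T / 2) * (z * ∑ x, F x + z * ∑ x, F x) := by rw [hFsum, hT]; ring
    _ ≤ -(T / 2) * (∑ b, F (tgt b) + ∑ b, F (src b)) := by
        have : ∑ b, F (tgt b) + ∑ b, F (src b) ≤ z * ∑ x, F x + z * ∑ x, F x := add_le_add htgt hsrc
        nlinarith
    _ = ∑ q : Bd × Cp, -(T * (((∑ j, Rm q.1 q.2 j * v (tgt q.1, j)) ^ 2 + v (src q.1, q.2) ^ 2) / 2)) := hsum.symm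
    _ ≤ _ := by
        rw [← Finset.sum_sub_distrib]
        exact Finset.sum_le_sum fun q _ => hterm q

/-! ## §4  The block-mean part of the error -/

/-- The transported site vector g(x) = (tr x)v(x) (MODEL bookkeeping). [folklore] -/
def gtr [Fintype Cp] [DecidableEq Cp] (v : St × Cp → ℝ) (x : St) (i : Cp) : ℝ := ∑ j, K.tr Rm x i j * v (x, j)

/-- The covariant mean as a block sum of g. [folklore] -/
theorem covMean_eq_sum_gtr [Fintype St] [DecidableEq B] [Fintype Cp] [DecidableEq Cp] (v : St × Cp → ℝ)
    (β : B) (i : Cp) :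
    covMean K w Rm v (β, i) = w β * ∑ x ∈ univ.filter (fun x => K.blk x = β), gtr K Rm v x i := by
  rw [covMean_apply, Finset.sum_filter]
  rfl

/-- The covariant mean of a conjugated field: Q_U(e^{φ}v)(β, i) = w(β)·Σ_{x ∈ β} e^{φ(x)} g(x)_i. [folklore] -/
theorem covMean_expW [Fintype St] [DecidableEq B] [Fintype Cp] [DecidableEq Cp] (φ : St → ℝ)
    (v : St × Cp → ℝ) (β : B) (i : Cp) :
    covMean K w Rm (expW φ v) (β, i) =
      w β * ∑ x ∈ univ.filter (fun x => K.blk x = β), Real.exp (φ x) * gtr K Rm v x i := by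
  rw [covMean_apply, Finset.sum_filter]
  congr 1
  refine Finset.sum_congr rfl fun x _ => ?_
  split_ifs with h
  · unfold gtr
    rw [Finset.mul_sum]
    exact Finset.sum_congr rfl fun j _ => by rw [expW_apply]; ring
  · rfl

/-- **Oscillation of the weight over a comb path**: |φ(x) − φ(base of the block of x)| ≤ depth(x)·θ.
[folklore] -/
theorem abs_sub_base_le (φ : St → ℝ) {θ : ℝ} (hφ : ∀ b, |φ (tgt b) - φ (src b)| ≤ θ) (x : St) :
    |φ x - φ (K.base (K.blk x))| ≤ K.depth x * θ := by
  suffices h : ∀ n y, K.depth y = n → |φ y - φ (K.base (K.blk y))| ≤ n * θ by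
    exact h _ x rfl
  intro n
  induction n with
  | zero =>
      intro y hy
      rw [← K.eq_base y hy, sub_self, abs_zero, Nat.cast_zero, zero_mul]
  | succ n ih =>
      intro y hy
      have hy0 : K.depth y ≠ 0 := by omega
      have hp : K.depth (K.parent y) = n := by
        have := K.depth_parent y hy0
        omega
      have hb := hφ (K.pbond y)
      rw [K.tgt_pbond y hy0, K.src_pbond y hy0] at hb
      have ihp := ih _ hp
      rw [K.blk_parent y hy0] at ihp
      push_cast
      calc |φ y - φ (K.base (K.blk y))|
          ≤ |φ y - φ (K.parent y)| + |φ (K.parent y) - φ (K.base (K.blk y))| := abs_sub_le _ _ _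
        _ ≤ θ + n * θ := add_le_add hb ihp
        _ = (n + 1) * θ := by ring

/-- **Oscillation over a block**: depth ≤ D ⇒ |φ(x) − φ(x′)| ≤ 2Dθ for x, x′ in the same block (θ ≥ 0).
[folklore] -/
theorem abs_sub_le_of_blk_eq (φ : St → ℝ) {θ : ℝ} (hθ : 0 ≤ θ) (hφ : ∀ b, |φ (tgt b) - φ (src b)| ≤ θ)
    {D : ℕ} (hD : ∀ x, K.depth x ≤ D) {x x' : St} (h : K.blk x = K.blk x') :
    |φ x - φ x'| ≤ 2 * D * θ := by
  have hx := abs_sub_base_le K φ hφ x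
  have hx' := abs_sub_base_le K φ hφ x'
  rw [← h] at hx'
  have hdx : (K.depth x : ℝ) * θ ≤ D * θ := mul_le_mul_of_nonneg_right (by exact_mod_cast hD x) hθ
  have hdx' : (K.depth x' : ℝ) * θ ≤ D * θ := mul_le_mul_of_nonneg_right (by exact_mod_cast hD x') hθ
  calc |φ x - φ x'| ≤ |φ x - φ (K.base (K.blk x))| + |φ (K.base (K.blk x)) - φ x'| := abs_sub_le _ _ _
    _ ≤ D * θ + D * θ := add_le_add (hx.trans hdx) (by rw [abs_sub_comm]; exact hx'.trans hdx')
    _ = 2 * D * θ := by ring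

/-- **The Q_U-part of the conjugation error.** For isometric bond matrices, |w(β)| ≤ w_max, comb depth ≤ D, blocks
of at most n sites and a site weight with |φ(b₊) − φ(b₋)| ≤ θ on every bond (θ ≥ 0):
Σ_q Q_U(e^{φ}v)(q)·Q_U(e^{−φ}v)(q) − Σ_q (Q_U v(q))² ≥ −w_max²·(e^{2Dθ} − 1)·n·Σ_p v(p)². [folklore] -/
theorem qPart_ge [Fintype St] [DecidableEq St] [Fintype B] [DecidableEq B] [Fintype Cp] [DecidableEq Cp]
    (hRm : ∀ b i j, ∑ k, Rm b k i * Rm b k j = if i = j then (1 : ℝ) else 0)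
    {wmax : ℝ} (hw' : ∀ β, |w β| ≤ wmax) {D : ℕ} (hD : ∀ x, K.depth x ≤ D)
    {n : ℕ} (hn : ∀ β, (univ.filter fun x => K.blk x = β).card ≤ n) {θ : ℝ} (hθ : 0 ≤ θ) (φ : St → ℝ)
    (hφ : ∀ b, |φ (tgt b) - φ (src b)| ≤ θ) (v : St × Cp → ℝ) :
    -(wmax ^ 2 * (Real.exp (2 * D * θ) - 1) * n * ∑ p, v p ^ 2) ≤
      ∑ q, covMean K w Rm (expW φ v) q * covMean K w Rm (expW (fun x => -φ x) v) q -
        ∑ q, covMean K w Rm v q ^ 2 := by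
  set Λ := Real.exp (2 * D * θ) - 1 with hΛ
  have hΛ0 : 0 ≤ Λ := by
    have : 0 ≤ 2 * (D : ℝ) * θ := by positivity
    linarith [Real.one_le_exp_iff.mpr this]
  -- the block energies
  set G : B → Cp → ℝ := fun β i => ∑ x ∈ univ.filter (fun x => K.blk x = β), gtr K Rm v x i ^ 2 with hG
  have hG0 : ∀ β i, 0 ≤ G β i := fun β i => Finset.sum_nonneg fun x _ => sq_nonneg _
  have hGsum : ∑ β, ∑ i, G β i = ∑ p, v p ^ 2 := by
    rw [sum_sq_eq_sum_sq_tr K Rm hRm v,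
      ← Finset.sum_fiberwise_of_maps_to (s := univ) (t := univ) (g := K.blk) (fun x _ => mem_univ _)]
    refine Finset.sum_congr rfl fun β _ => ?_
    rw [Finset.sum_comm]
    rfl
  -- termwise bound
  have hterm : ∀ β i, -(wmax ^ 2 * Λ * n * G β i) ≤
      covMean K w Rm (expW φ v) (β, i) * covMean K w Rm (expW (fun x => -φ x) v) (β, i) -
        covMean K w Rm v (β, i) ^ 2 := by
    intro β i
    set s := univ.filter (fun x => K.blk x = β) with hs
    rw [covMean_expW, covMean_expW, covMean_eq_sum_gtr]
    -- expand the products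
    set X := ∑ x ∈ s, ∑ x' ∈ s, (Real.exp (φ x) * Real.exp (-φ x') - 1) * (gtr K Rm v x i * gtr K Rm v x' i)
      with hX
    have e : w β * (∑ x ∈ s, Real.exp (φ x) * gtr K Rm v x i) *
        (w β * ∑ x ∈ s, Real.exp (-φ x) * gtr K Rm v x i) - (w β * ∑ x ∈ s, gtr K Rm v x i) ^ 2 =
          w β ^ 2 * X := by
      rw [hX]
      have e1 : (∑ x ∈ s, Real.exp (φ x) * gtr K Rm v x i) * (∑ x ∈ s, Real.exp (-φ x) * gtr K Rm v x i) -
          (∑ x ∈ s, gtr K Rm v x i) ^ 2 =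
            ∑ x ∈ s, ∑ x' ∈ s, (Real.exp (φ x) * Real.exp (-φ x') - 1) * (gtr K Rm v x i * gtr K Rm v x' i) := by
        rw [sq, Finset.sum_mul_sum, Finset.sum_mul_sum, ← Finset.sum_sub_distrib]
        refine Finset.sum_congr rfl fun x _ => ?_
        rw [← Finset.sum_sub_distrib]
        exact Finset.sum_congr rfl fun x' _ => by ring
      rw [← e1]
      ring
    rw [e]
    -- |X| ≤ Λ (Σ |g|)² ≤ Λ n G
    have hosc : ∀ x ∈ s, ∀ x' ∈ s, |Real.exp (φ x) * Real.exp (-φ x') - 1| ≤ Λ := by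
      intro x hx x' hx'
      rw [← Real.exp_add, ← sub_eq_add_neg]
      exact abs_exp_sub_one_le
        (abs_sub_le_of_blk_eq K φ hθ hφ hD (((mem_filter.mp hx).2).trans ((mem_filter.mp hx').2).symm))
    have hXle : |X| ≤ Λ * (∑ x ∈ s, |gtr K Rm v x i|) ^ 2 := by
      calc |X| ≤ ∑ x ∈ s, |∑ x' ∈ s, (Real.exp (φ x) * Real.exp (-φ x') - 1) * (gtr K Rm v x i * gtr K Rm v x' i)| :=
            Finset.abs_sum_le_sum_abs _ _
        _ ≤ ∑ x ∈ s, ∑ x' ∈ s, |(Real.exp (φ x) * Real.exp (-φ x') - 1) * (gtr K Rm v x i * gtr K Rm v x' i)| :=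
            Finset.sum_le_sum fun x _ => Finset.abs_sum_le_sum_abs _ _
        _ ≤ ∑ x ∈ s, ∑ x' ∈ s, Λ * (|gtr K Rm v x i| * |gtr K Rm v x' i|) := by
            refine Finset.sum_le_sum fun x hx => Finset.sum_le_sum fun x' hx' => ?_
            rw [abs_mul, abs_mul (gtr K Rm v x i)]
            exact mul_le_mul_of_nonneg_right (hosc x hx x' hx') (mul_nonneg (abs_nonneg _) (abs_nonneg _))
        _ = Λ * (∑ x ∈ s, |gtr K Rm v x i|) ^ 2 := by
            rw [sq, Finset.sum_mul_sum, Finset.mul_sum]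
            refine Finset.sum_congr rfl fun x _ => ?_
            rw [Finset.mul_sum]
    have hcs : (∑ x ∈ s, |gtr K Rm v x i|) ^ 2 ≤ n * G β i := by
      calc (∑ x ∈ s, |gtr K Rm v x i|) ^ 2 ≤ s.card * ∑ x ∈ s, |gtr K Rm v x i| ^ 2 := sq_sum_le_card_mul_sum_sq
        _ = s.card * G β i := by
            simp only [hG, hs, sq_abs]
        _ ≤ n * G β i := mul_le_mul_of_nonneg_right (by exact_mod_cast hn β) (hG0 β i)
    have hX' : |X| ≤ Λ * (n * G β i) := hXle.trans (mul_le_mul_of_nonneg_left hcs hΛ0)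
    have hwb : w β ^ 2 ≤ wmax ^ 2 := by
      rw [← sq_abs (w β)]
      exact pow_le_pow_left₀ (abs_nonneg _) (hw' β) 2
    have h1 : -(w β ^ 2 * (Λ * (n * G β i))) ≤ w β ^ 2 * X := by
      have := neg_abs_le X
      nlinarith [sq_nonneg (w β)]
    have h2 : w β ^ 2 * (Λ * (n * G β i)) ≤ wmax ^ 2 * (Λ * (n * G β i)) :=
      mul_le_mul_of_nonneg_right hwb (mul_nonneg hΛ0 (mul_nonneg (Nat.cast_nonneg _) (hG0 β i)))
    calc -(wmax ^ 2 * Λ * n * G β i) = -(wmax ^ 2 * (Λ * (n * G β i))) := by ring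
      _ ≤ -(w β ^ 2 * (Λ * (n * G β i))) := neg_le_neg h2
      _ ≤ w β ^ 2 * X := h1
  -- sum of the termwise bounds
  calc -(wmax ^ 2 * (Real.exp (2 * D * θ) - 1) * n * ∑ p, v p ^ 2)
      = ∑ β, ∑ i, -(wmax ^ 2 * Λ * n * G β i) := by
        rw [← hGsum, Finset.mul_sum, ← Finset.sum_neg_distrib]
        refine Finset.sum_congr rfl fun β _ => ?_
        rw [Finset.mul_sum, ← Finset.sum_neg_distrib]
    _ ≤ ∑ β, ∑ i, (covMean K w Rm (expW φ v) (β, i) * covMean K w Rm (expW (fun x => -φ x) v) (β, i) -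
          covMean K w Rm v (β, i) ^ 2) :=
        Finset.sum_le_sum fun β _ => Finset.sum_le_sum fun i _ => hterm β i
    _ = _ := by
        rw [← Finset.sum_sub_distrib, Fintype.sum_prod_type]

/-! ## §5  The conjugation error of Δ_U + a·Q_UᵀQ_U and the Combes–Thomas bound -/

/-- The bilinear form of the model operator: ⟨u, (Δ_U + a·Q_UᵀQ_U)v⟩ = Σ (∇_U u)(∇_U v) + a·Σ (Q_U u)(Q_U v).
[cite: Balaban1985BackgroundPropagators, (3.23)–(3.24) p.394] -/
theorem bilin_covLapCov [Fintype St] [DecidableEq St] [Fintype Bd] [Fintype B] [DecidableEq B] [Fintype Cp]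
    [DecidableEq Cp] (a : ℝ) (u v : St × Cp → ℝ) :
    ∑ p, u p * covLapCov K c w Rm a v p =
      ∑ q, covD src tgt c Rm u q * covD src tgt c Rm v q + a * ∑ q, covMean K w Rm u q * covMean K w Rm v q := by
  rw [isTransposePair_covD src tgt c Rm u (covD src tgt c Rm v),
    isTransposePair_covMean K w Rm u (covMean K w Rm v), Finset.mul_sum, ← Finset.sum_add_distrib]
  refine Finset.sum_congr rfl fun p _ => ?_
  simp only [covLapCov, LinearMap.add_apply, Pi.add_apply, LinearMap.comp_apply, LinearMap.smul_apply,
    Pi.smul_apply, smul_eq_mul]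
  ring

/-- **The smallness functional** κ(θ) = c_max²(e^θ − 1)z + a·w_max²(e^{2Dθ} − 1)n of the Combes–Thomas argument
for the model Δ_U + a·Q_UᵀQ_U (MODEL bookkeeping). [folklore] -/
def kappa (θ cmax wmax a : ℝ) (z D n : ℕ) : ℝ :=
  cmax ^ 2 * (Real.exp θ - 1) * z + a * (wmax ^ 2 * (Real.exp (2 * D * θ) - 1) * n)

/-- **THE CONJUGATION ERROR OF Δ_U + a·Q_UᵀQ_U** (MODEL): for isometric bond matrices, |c(b)| ≤ c_max,
|w(β)| ≤ w_max, a ≥ 0, comb depth ≤ D, blocks of ≤ n sites, bond degrees ≤ z and a site weight with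
|φ(b₊) − φ(b₋)| ≤ θ (θ ≥ 0):  ERR_φ(Δ_U + a·Q_UᵀQ_U; v) ≥ −κ(θ)·Σ_p v(p)² for EVERY field v — uniform in the
transport. [folklore] -/
theorem conjErr_covLapCov_ge [Fintype St] [DecidableEq St] [Fintype Bd] [Fintype B] [DecidableEq B] [Fintype Cp]
    [DecidableEq Cp] (hRm : ∀ b i j, ∑ k, Rm b k i * Rm b k j = if i = j then (1 : ℝ) else 0)
    {cmax : ℝ} (hc' : ∀ b, |c b| ≤ cmax) {wmax : ℝ} (hw' : ∀ β, |w β| ≤ wmax) {D : ℕ} (hD : ∀ x, K.depth x ≤ D)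
    {n : ℕ} (hn : ∀ β, (univ.filter fun x => K.blk x = β).card ≤ n) {a : ℝ} (ha : 0 ≤ a) {θ : ℝ} (hθ : 0 ≤ θ)
    (φ : St → ℝ) (hφ : ∀ b, |φ (tgt b) - φ (src b)| ≤ θ) {z : ℕ}
    (hzs : ∀ x, (univ.filter fun b => src b = x).card ≤ z) (hzt : ∀ x, (univ.filter fun b => tgt b = x).card ≤ z)
    (v : St × Cp → ℝ) :
    -(kappa θ cmax wmax a z D n * ∑ p, v p ^ 2) ≤ conjErr (covLapCov K c w Rm a) φ v := by
  unfold conjErr kappa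
  rw [bilin_covLapCov, bilin_covLapCov]
  have hd := dPart_ge c Rm hRm hc' hθ φ hφ hzs hzt v
  have hq := qPart_ge K w Rm hRm hw' hD hn hθ φ hφ v
  have hsq1 : ∑ q, covD src tgt c Rm v q * covD src tgt c Rm v q = ∑ q, covD src tgt c Rm v q ^ 2 :=
    Finset.sum_congr rfl fun q _ => (sq _).symm
  have hsq2 : ∑ q, covMean K w Rm v q * covMean K w Rm v q = ∑ q, covMean K w Rm v q ^ 2 :=
    Finset.sum_congr rfl fun q _ => (sq _).symm
  rw [hsq1, hsq2]
  have hq' := mul_le_mul_of_nonneg_left hq ha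
  nlinarith [hd, hq']

/-- **COMBES–THOMAS BOUND IN WEIGHTED ℓ², UNIFORM IN THE TRANSPORT (MODEL of the decay (3.42) for the one-step
Δ_U + a·Q_UᵀQ_U).**  Hypotheses: isometric bond matrices; c_min ≤ |c(b)| ≤ c_max (c_min > 0); w_min ≤ |w(β)| ≤ w_max
(w_min > 0); comb depth ≤ D; blocks of ≤ n sites; bond degrees ≤ z; a > 0; a site weight φ with |φ(b₊) − φ(b₋)| ≤ θ
(θ ≥ 0) and the smallness κ(θ) ≤ σ/2, σ = σ(a, w_min, c_min, D, n) the coercivity constant of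
`B9Thm37GlueTorusCovPoinc`.  Then for EVERY right-hand side g:
Σ_p (e^{φ(p)}((Δ_U + a·Q_UᵀQ_U)⁻¹g)(p))² ≤ (2/σ)²·Σ_p (e^{φ(p)}g(p))².  Proof: `coercive_covLapCov` +
`conjErr_covLapCov_ge` fed into `Beta.CombesThomasFormOp.combesThomas_form_op`.
[cite: Balaban1985BackgroundPropagators, (3.42) p.397; (3.23)–(3.24) p.394; p.395] -/
theorem weighted_inverse_sq_le [Fintype St] [DecidableEq St] [Fintype Bd] [Fintype B] [DecidableEq B] [Fintype Cp]
    [DecidableEq Cp] (hRm : ∀ b i j, ∑ k, Rm b k i * Rm b k j = if i = j then (1 : ℝ) else 0)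
    {cmin cmax : ℝ} (hcmin : 0 < cmin) (hc : ∀ b, cmin ≤ |c b|) (hc' : ∀ b, |c b| ≤ cmax)
    {wmin wmax : ℝ} (hwmin : 0 < wmin) (hw : ∀ β, wmin ≤ |w β|) (hw' : ∀ β, |w β| ≤ wmax)
    {D : ℕ} (hD : ∀ x, K.depth x ≤ D) {n : ℕ} (hn : ∀ β, (univ.filter fun x => K.blk x = β).card ≤ n)
    {a : ℝ} (ha : 0 < a) {θ : ℝ} (hθ : 0 ≤ θ) (φ : St → ℝ) (hφ : ∀ b, |φ (tgt b) - φ (src b)| ≤ θ) {z : ℕ}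
    (hzs : ∀ x, (univ.filter fun b => src b = x).card ≤ z) (hzt : ∀ x, (univ.filter fun b => tgt b = x).card ≤ z)
    (hκ : kappa θ cmax wmax a z D n ≤ sigma a wmin cmin D n / 2) (g : St × Cp → ℝ) :
    ∑ p, (Real.exp (φ p.1) * Ring.inverse (covLapCov K c w Rm a) g p) ^ 2 ≤
      (2 / sigma a wmin cmin D n) ^ 2 * ∑ p, (Real.exp (φ p.1) * g p) ^ 2 := by
  have hc0 : ∀ b, c b ≠ 0 := fun b h0 => by have := hc b; rw [h0, abs_zero] at this; linarith
  have hw0 : ∀ β, w β ≠ 0 := fun β h0 => by have := hw β; rw [h0, abs_zero] at this; linarith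
  set A := covLapCov K c w Rm a with hA
  set σ := sigma a wmin cmin D n with hσdef
  have hσ : 0 < σ := sigma_pos ha hwmin cmin D n
  set H := LinearMap.toMatrix' A with hH
  have hmv : ∀ u : St × Cp → ℝ, H.mulVec u = A u := fun u => by
    rw [hH, ← Matrix.toLin'_apply, Matrix.toLin'_toMatrix']
  have hdot : ∀ u : St × Cp → ℝ, u ⬝ᵥ u = ∑ p, u p ^ 2 := fun u => Finset.sum_congr rfl fun p _ => (sq _).symm
  have hpos : ∀ ω : St × Cp → ℝ, σ * (ω ⬝ᵥ ω) ≤ ω ⬝ᵥ H.mulVec ω := by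
    intro ω
    rw [hmv, hdot]
    exact coercive_covLapCov K c w Rm hRm hcmin hc hwmin hw hD hn ha ω
  have herr : ∀ u : St × Cp → ℝ, -(σ / 2) * (u ⬝ᵥ u) ≤
      ∑ j, ∑ k, (Real.exp ((fun p : St × Cp => φ p.1) j - (fun p : St × Cp => φ p.1) k) - 1) * H j k *
        (u j * u k) := by
    intro u
    rw [hdot]
    have h := conjErr_covLapCov_ge K c w Rm hRm hc' hw' hD hn ha.le hθ φ hφ hzs hzt u
    rw [conjErr_eq_matrix] at h
    have h0 : 0 ≤ ∑ p, u p ^ 2 := Finset.sum_nonneg fun p _ => sq_nonneg _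
    have h1 : kappa θ cmax wmax a z D n * ∑ p, u p ^ 2 ≤ σ / 2 * ∑ p, u p ^ 2 :=
      mul_le_mul_of_nonneg_right hκ h0
    simp only
    linarith
  have hv : H.mulVec (Ring.inverse A g) = g := by
    rw [hmv]
    have h := mul_inverse_covLapCov K c w Rm hRm hc0 hw0 ha
    have := congrArg (fun T : Module.End ℝ (St × Cp → ℝ) => T g) h
    simpa [Module.End.mul_apply] using this
  exact combesThomas_form_op H σ (fun p : St × Cp => φ p.1) hσ hpos herr g (Ring.inverse A g) hv

/-- **ENTRYWISE COMBES–THOMAS DECAY, UNIFORM IN THE TRANSPORT (MODEL of (3.42)).**  Under the hypotheses of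
`weighted_inverse_sq_le`: |(Δ_U + a·Q_UᵀQ_U)⁻¹(p, p₀)| ≤ (2/σ)·e^{−(φ(p) − φ(p₀))} for all sites-with-colour p, p₀,
for EVERY bond-θ-Lipschitz site weight φ with κ(θ) ≤ σ/2.
[cite: Balaban1985BackgroundPropagators, (3.42) p.397; (3.23)–(3.24) p.394; p.395] -/
theorem entry_le [Fintype St] [DecidableEq St] [Fintype Bd] [Fintype B] [DecidableEq B] [Fintype Cp]
    [DecidableEq Cp] (hRm : ∀ b i j, ∑ k, Rm b k i * Rm b k j = if i = j then (1 : ℝ) else 0)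
    {cmin cmax : ℝ} (hcmin : 0 < cmin) (hc : ∀ b, cmin ≤ |c b|) (hc' : ∀ b, |c b| ≤ cmax)
    {wmin wmax : ℝ} (hwmin : 0 < wmin) (hw : ∀ β, wmin ≤ |w β|) (hw' : ∀ β, |w β| ≤ wmax)
    {D : ℕ} (hD : ∀ x, K.depth x ≤ D) {n : ℕ} (hn : ∀ β, (univ.filter fun x => K.blk x = β).card ≤ n)
    {a : ℝ} (ha : 0 < a) {θ : ℝ} (hθ : 0 ≤ θ) (φ : St → ℝ) (hφ : ∀ b, |φ (tgt b) - φ (src b)| ≤ θ) {z : ℕ}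
    (hzs : ∀ x, (univ.filter fun b => src b = x).card ≤ z) (hzt : ∀ x, (univ.filter fun b => tgt b = x).card ≤ z)
    (hκ : kappa θ cmax wmax a z D n ≤ sigma a wmin cmin D n / 2) (p₀ p : St × Cp) :
    |Ring.inverse (covLapCov K c w Rm a) (Pi.single p₀ 1) p| ≤
      2 / sigma a wmin cmin D n * Real.exp (-(φ p.1 - φ p₀.1)) := by
  have h := weighted_inverse_sq_le K c w Rm hRm hcmin hc hc' hwmin hw hw' hD hn ha hθ φ hφ hzs hzt hκ (Pi.single p₀ 1)
  have hσ : 0 < sigma a wmin cmin D n := sigma_pos ha hwmin cmin D n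
  set σ := sigma a wmin cmin D n with hσdef
  set G := Ring.inverse (covLapCov K c w Rm a) (Pi.single p₀ 1) with hG
  have hrhs : ∑ q : St × Cp, (Real.exp (φ q.1) * (Pi.single p₀ (1 : ℝ) : St × Cp → ℝ) q) ^ 2 =
      Real.exp (φ p₀.1) ^ 2 := by
    rw [Finset.sum_eq_single p₀ (fun q _ hq => by rw [Pi.single_eq_of_ne hq, mul_zero, sq, mul_zero])
      (fun h => absurd (mem_univ p₀) h), Pi.single_eq_same, mul_one]
  rw [hrhs] at h
  have hlhs : (Real.exp (φ p.1) * G p) ^ 2 ≤ ∑ q, (Real.exp (φ q.1) * G q) ^ 2 :=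
    Finset.single_le_sum (fun q _ => sq_nonneg (Real.exp (φ q.1) * G q)) (mem_univ p)
  have hsq : (Real.exp (φ p.1) * G p) ^ 2 ≤ (2 / σ * Real.exp (φ p₀.1)) ^ 2 := by
    rw [mul_pow (2 / σ) (Real.exp (φ p₀.1)) 2]
    exact hlhs.trans h
  have hb : 0 ≤ 2 / σ * Real.exp (φ p₀.1) := mul_nonneg (div_nonneg zero_le_two hσ.le) (Real.exp_pos _).le
  have habs := abs_le_of_sq_le_sq hsq hb
  rw [abs_mul, abs_of_pos (Real.exp_pos _)] at habs
  have hE := Real.exp_pos (φ p.1)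
  calc |G p| = Real.exp (-φ p.1) * (Real.exp (φ p.1) * |G p|) := by
        rw [← mul_assoc, ← Real.exp_add, neg_add_cancel, Real.exp_zero, one_mul]
    _ ≤ Real.exp (-φ p.1) * (2 / σ * Real.exp (φ p₀.1)) := mul_le_mul_of_nonneg_left habs (Real.exp_pos _).le
    _ = 2 / σ * Real.exp (-(φ p.1 - φ p₀.1)) := by
        rw [show -(φ p.1 - φ p₀.1) = φ p₀.1 + -φ p.1 by ring, Real.exp_add]
        ring

/-! ## §6  An admissible θ -/

/-- **An admissible decay rate**: θ_adm = min(1/(2D+1), σ/(2L+1)), L = 2c_max²z + 4a·w_max²·D·n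
(MODEL bookkeeping). [folklore] -/
def thetaAdm (σ cmax wmax a : ℝ) (z D n : ℕ) : ℝ :=
  min (1 / (2 * (D : ℝ) + 1)) (σ / (2 * (2 * cmax ^ 2 * z + 4 * a * wmax ^ 2 * D * n) + 1))

/-- θ_adm > 0 (σ > 0, a ≥ 0). [folklore] -/
theorem thetaAdm_pos {σ a : ℝ} (hσ : 0 < σ) (ha : 0 ≤ a) (cmax wmax : ℝ) (z D n : ℕ) :
    0 < thetaAdm σ cmax wmax a z D n := by
  unfold thetaAdm
  refine lt_min (by positivity) (div_pos hσ ?_)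
  have : 0 ≤ 2 * cmax ^ 2 * z + 4 * a * wmax ^ 2 * D * n := by positivity
  linarith

/-- **θ_adm is admissible**: κ(θ_adm) ≤ σ/2 (σ > 0, a ≥ 0). [folklore] -/
theorem kappa_thetaAdm_le {σ a : ℝ} (hσ : 0 < σ) (ha : 0 ≤ a) (cmax wmax : ℝ) (z D n : ℕ) :
    kappa (thetaAdm σ cmax wmax a z D n) cmax wmax a z D n ≤ σ / 2 := by
  set θ := thetaAdm σ cmax wmax a z D n with hθdef
  set L := 2 * cmax ^ 2 * z + 4 * a * wmax ^ 2 * D * n with hL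
  have hL0 : 0 ≤ L := by positivity
  have hθ0 : 0 < θ := thetaAdm_pos hσ ha cmax wmax z D n
  have hθ1 : θ ≤ 1 / (2 * (D : ℝ) + 1) := min_le_left _ _
  have hθ2 : θ ≤ σ / (2 * L + 1) := min_le_right _ _
  have hD0 : (0 : ℝ) ≤ D := Nat.cast_nonneg _
  have hD1 : 0 < 2 * (D : ℝ) + 1 := by linarith
  have hθD : θ * (2 * D + 1) ≤ 1 := by
    have := (le_div_iff₀ hD1).mp hθ1
    linarith
  have hle1 : θ ≤ 1 := by nlinarith
  have h2D0 : 0 ≤ 2 * (D : ℝ) * θ := by positivity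
  have h2D1 : 2 * (D : ℝ) * θ ≤ 1 := by nlinarith
  have hexp : ∀ x : ℝ, 0 ≤ x → x ≤ 1 → Real.exp x - 1 ≤ 2 * x := fun x h0 h1 => by
    have h := Real.abs_exp_sub_one_le (x := x) (by rw [abs_of_nonneg h0]; exact h1)
    rw [abs_of_nonneg h0] at h
    exact (le_abs_self _).trans h
  have he1 : Real.exp θ - 1 ≤ 2 * θ := hexp θ hθ0.le hle1
  have he2 : Real.exp (2 * D * θ) - 1 ≤ 2 * (2 * D * θ) := hexp _ h2D0 h2D1
  have hκ : kappa θ cmax wmax a z D n ≤ θ * L := by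
    unfold kappa
    have t1 : cmax ^ 2 * (Real.exp θ - 1) * z ≤ cmax ^ 2 * (2 * θ) * z :=
      mul_le_mul_of_nonneg_right (mul_le_mul_of_nonneg_left he1 (sq_nonneg _)) (Nat.cast_nonneg _)
    have t2 : a * (wmax ^ 2 * (Real.exp (2 * D * θ) - 1) * n) ≤ a * (wmax ^ 2 * (2 * (2 * D * θ)) * n) :=
      mul_le_mul_of_nonneg_left
        (mul_le_mul_of_nonneg_right (mul_le_mul_of_nonneg_left he2 (sq_nonneg _)) (Nat.cast_nonneg _)) ha
    calc _ ≤ cmax ^ 2 * (2 * θ) * z + a * (wmax ^ 2 * (2 * (2 * D * θ)) * n) := add_le_add t1 t2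
      _ = θ * L := by rw [hL]; ring
  have hL1 : 0 < 2 * L + 1 := by linarith
  have hθL : θ * (2 * L + 1) ≤ σ := (le_div_iff₀ hL1).mp hθ2
  nlinarith

end Generic

/-! ## §7  The torus: Combes–Thomas decay of (Δ_U + a·Q_UᵀQ_U)⁻¹ uniform in the volume and in U -/

section Torus

variable {d : ℕ} {N : Fin d → ℕ}

/-- At most d nearest-neighbour bonds start at a torus site. [folklore] -/
theorem card_filter_bsrc_le [∀ i, NeZero (N i)] (x : UT N) :
    (univ.filter fun b : UT N × Fin d => bsrc b = x).card ≤ d := by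
  have h := Finset.card_le_card_of_injOn (fun b : UT N × Fin d => b.2) (fun b _ => mem_univ _)
    (s := univ.filter fun b : UT N × Fin d => bsrc b = x) (t := univ) ?_
  · simpa using h
  · intro b hb b' hb' hμ
    have h1 : b.1 = x := (mem_filter.mp hb).2
    have h2 : b'.1 = x := (mem_filter.mp hb').2
    exact Prod.ext (h1.trans h2.symm) hμ

/-- x ↦ x + e_μ is injective on the torus. [folklore] -/
theorem up_injective [∀ i, NeZero (N i)] (μ : Fin d) : Function.Injective fun y : UT N => up y μ :=
  Finite.injective_iff_surjective.mpr fun x => ⟨dn x μ, up_dn x μ⟩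

/-- At most d nearest-neighbour bonds end at a torus site. [folklore] -/
theorem card_filter_btgt_le [∀ i, NeZero (N i)] (x : UT N) :
    (univ.filter fun b : UT N × Fin d => btgt b = x).card ≤ d := by
  have h := Finset.card_le_card_of_injOn (fun b : UT N × Fin d => b.2) (fun b _ => mem_univ _)
    (s := univ.filter fun b : UT N × Fin d => btgt b = x) (t := univ) ?_
  · simpa using h
  · intro b hb b' hb' hμ
    have h1 : up b.1 b.2 = x := (mem_filter.mp hb).2
    have h2 : up b'.1 b'.2 = x := (mem_filter.mp hb').2
    have hμ' : b.2 = b'.2 := hμ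
    rw [hμ'] at h1
    exact Prod.ext (up_injective b'.2 (h1.trans h2.symm)) hμ'

/-- The weight θ·dist(x₀, ·) is θ-Lipschitz across nearest-neighbour bonds (θ ≥ 0). [folklore] -/
theorem abs_sub_dist_le [∀ i, NeZero (N i)] (x₀ : UT N) {θ : ℝ} (hθ : 0 ≤ θ) (b : UT N × Fin d) :
    |θ * dist x₀ (btgt b) - θ * dist x₀ (bsrc b)| ≤ θ := by
  rw [← mul_sub, abs_mul, abs_of_nonneg hθ]
  refine mul_le_of_le_one_right hθ ?_
  obtain ⟨y, μ⟩ := b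
  rw [btgt_apply, bsrc_apply, dist_comm x₀ (up y μ), dist_comm x₀ y]
  exact (abs_dist_sub_le (up y μ) y x₀).trans (by rw [dist_comm]; exact dist_up_le y μ)

variable [∀ i, NeZero (N i)] [NeZero d]

/-- **COMBES–THOMAS DECAY ON THE TORUS, UNIFORM IN THE VOLUME AND IN THE TRANSPORT (MODEL of (3.42) for the
one-step Δ_U + a·Q_UᵀQ_U).**  For every torus `UT N` with 1 ≤ M₀, M₀ ∣ N_i, every isometric transport (hRm), bond
weights c_min ≤ |c(b)| ≤ c_max (c_min > 0), block weights w_min ≤ |w(z)| ≤ w_max (w_min > 0), a > 0 and every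
θ ≥ 0 with κ_T(θ) = c_max²(e^θ − 1)d + a·w_max²(e^{2d(M₀−1)θ} − 1)M₀^d ≤ σ_T/2 (σ_T = `sigmaTorus`):
|(Δ_U + a·Q_UᵀQ_U)⁻¹(p, p₀)| ≤ (2/σ_T)·e^{−θ·dist(p₀, p)} — the constants see neither N nor U.
[cite: Balaban1985BackgroundPropagators, (3.42) p.397; (3.23)–(3.24) p.394; p.395] -/
theorem entry_decay_torus {Cp : Type} [Fintype Cp] [DecidableEq Cp] {M₀ : ℕ} (hM : 1 ≤ M₀)
    (hdiv : ∀ i, M₀ ∣ N i) (c : UT N × Fin d → ℝ) {cmin cmax : ℝ} (hcmin : 0 < cmin) (hc : ∀ b, cmin ≤ |c b|)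
    (hc' : ∀ b, |c b| ≤ cmax) (w : Ctr N M₀ → ℝ) {wmin wmax : ℝ} (hwmin : 0 < wmin) (hw : ∀ β, wmin ≤ |w β|)
    (hw' : ∀ β, |w β| ≤ wmax) (Rm : UT N × Fin d → Cp → Cp → ℝ)
    (hRm : ∀ b i j, ∑ k, Rm b k i * Rm b k j = if i = j then (1 : ℝ) else 0) {a : ℝ} (ha : 0 < a)
    {θ : ℝ} (hθ : 0 ≤ θ) (hκ : kappa θ cmax wmax a d (d * (M₀ - 1)) (M₀ ^ d) ≤ sigmaTorus d M₀ a wmin cmin / 2)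
    (p₀ p : UT N × Cp) :
    |Ring.inverse (covLapCov (torusComb hM hdiv) c w Rm a) (Pi.single p₀ 1) p| ≤
      2 / sigmaTorus d M₀ a wmin cmin * Real.exp (-(θ * dist p₀.1 p.1)) := by
  have h := entry_le (torusComb hM hdiv) c w Rm hRm hcmin hc hc' hwmin hw hw' (fun x => tdepth_le hM x)
    (fun z => card_block_le hM hdiv z) ha hθ (fun x => θ * dist p₀.1 x) (fun b => abs_sub_dist_le p₀.1 hθ b)
    card_filter_bsrc_le card_filter_btgt_le hκ p₀ p
  simpa [dist_self, sigmaTorus] using h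

/-- **The admissible decay rate of the torus model** θ_T(d, M₀, c_min, c_max, w_min, w_max, a) > 0 — independent of
the torus and of the transport (MODEL bookkeeping). [folklore] -/
def thetaTorus (d M₀ : ℕ) (a wmin cmin cmax wmax : ℝ) : ℝ :=
  thetaAdm (sigmaTorus d M₀ a wmin cmin) cmax wmax a d (d * (M₀ - 1)) (M₀ ^ d)

/-- θ_T > 0. [folklore] -/
theorem thetaTorus_pos (d M₀ : ℕ) {a wmin : ℝ} (ha : 0 < a) (hwmin : 0 < wmin) (cmin cmax wmax : ℝ) :
    0 < thetaTorus d M₀ a wmin cmin cmax wmax :=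
  thetaAdm_pos (sigmaTorus_pos d M₀ ha hwmin cmin) ha.le cmax wmax _ _ _

/-- **EXPONENTIAL DECAY OF (Δ_U + a·Q_UᵀQ_U)⁻¹ ON EVERY TORUS WITH EXPLICIT N- AND U-INDEPENDENT CONSTANTS (MODEL of
(3.42)).**  |(Δ_U + a·Q_UᵀQ_U)⁻¹(p, p₀)| ≤ (2/σ_T)·e^{−θ_T·dist(p₀, p)} with σ_T = `sigmaTorus d M₀ a wmin cmin` and
θ_T = `thetaTorus d M₀ a wmin cmin cmax wmax` > 0, for every torus `UT N` (M₀ ∣ N_i), every isometric transport and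
all weights in the stated ranges. [cite: Balaban1985BackgroundPropagators, (3.42) p.397; (3.23)–(3.24) p.394; p.395] -/
theorem entry_decay_torus_explicit {Cp : Type} [Fintype Cp] [DecidableEq Cp] {M₀ : ℕ} (hM : 1 ≤ M₀)
    (hdiv : ∀ i, M₀ ∣ N i) (c : UT N × Fin d → ℝ) {cmin cmax : ℝ} (hcmin : 0 < cmin) (hc : ∀ b, cmin ≤ |c b|)
    (hc' : ∀ b, |c b| ≤ cmax) (w : Ctr N M₀ → ℝ) {wmin wmax : ℝ} (hwmin : 0 < wmin) (hw : ∀ β, wmin ≤ |w β|)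
    (hw' : ∀ β, |w β| ≤ wmax) (Rm : UT N × Fin d → Cp → Cp → ℝ)
    (hRm : ∀ b i j, ∑ k, Rm b k i * Rm b k j = if i = j then (1 : ℝ) else 0) {a : ℝ} (ha : 0 < a)
    (p₀ p : UT N × Cp) :
    |Ring.inverse (covLapCov (torusComb hM hdiv) c w Rm a) (Pi.single p₀ 1) p| ≤
      2 / sigmaTorus d M₀ a wmin cmin * Real.exp (-(thetaTorus d M₀ a wmin cmin cmax wmax * dist p₀.1 p.1)) :=
  entry_decay_torus hM hdiv c hcmin hc hc' w hwmin hw hw' Rm hRm ha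
    (thetaTorus_pos d M₀ ha hwmin cmin cmax wmax).le
    (kappa_thetaAdm_le (sigmaTorus_pos d M₀ ha hwmin cmin) ha.le cmax wmax _ _ _) p₀ p

end Torus

end

end Literature.MathematicalPhysics.QuantumFieldTheory.Balaban1983to89.B9Thm37GlueTorusCovCT
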